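import Summits.QuantumFields.BalabanUV.T4Continuum.Spine.NE7c.LiveFactorTowerPriced
import Summits.QuantumFields.BalabanUV.T4Continuum.Support.B16HistoryTowerExtractionEnd3
import Summits.QuantumFields.BalabanUV.T4Continuum.Spine.NE7b.GaussianDominatedMoment

/-!
# `T4Continuum.Spine.NE7c.LiveFactorTowerStep` — spine estimate NE7c (node U5b), road (δ) THRESHOLD RANDOMISATION against
# END3 = IR-104-2 «THE END ONE STEP DEEPER: EXTRACTION DERIVED FROM LOCAL CONDITIONAL STABILITY»
# (`Support/B16HistoryTowerExtractionStepDataLWR` p360455 + `Support/B16HistoryTowerExtractionEnd3`, gaps-ne6 g9): (§1) junction J-δ∕IR1042 —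
# the order of quantifiers of a threshold-parametric (A1c-0) builder against the record `TowerExtractionStepDataLWR` (level measures
# `μ K j`; the NE7c rows ⟨shA, shB, Wsh, shell⟩ are END2's at the diagonal `fun K => μ K K`); (§2) END3's ROAD at the lowered-threshold
# run's letters — one moved letter `γ₀ ↦ λ₀²γ₀`, one application; (§3) the OWNER's Gaussian inhabitant of LCS-j at a LOWERED threshold
# (cell `pub-balaban-gaps`, track G2, seat ne8 gen 10, file 17; record `HOME/ne/NE7c.md` §17)

HONEST FRAMING.  Finite four-torus programme, rung (B)+1 only — NOT infinite volume, NOT a mass gap, NOT the Clay problem, NOT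
summit progress, NOT a proof of NE7c (`T4IndicatorShell.ShellWeightBound`, INSTANCE 0∕1, which waits on node O ∕ the (A1c) instance)
and NOT a proof of NE7b (`T4WeightBudget.RelWeightBound`, NOT PRINTED, NOT PROVED).  Nothing of [Bałaban 1983–89] is asserted:
threshold randomisation (road (δ)) is the cell's device; END3's record `TowerExtractionStepDataLWR` is a displayed HYPOTHESIS SHAPE of
the NE7b lineage and its terminal theorem `continuumYM4Torus_of_towerExtractionStep_fsc` is CITED BY NAME (nothing of either edited);
(B) = `B16.EndStatementBPrinted` and `BetaPertHyp` enter §2 BY NAME as in END3; §3 is a statement about finite-dimensional Gaussian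
integrals (the OWNER t4-ne7b-p1 g105's `GaussianDominatedMoment`, cited by name) and says nothing about Bałaban's kernels.  Every
input is an explicit hypothesis; no `def`; 0 sorry.  Spine PROVED 0∕9 — unchanged by this file.

§1 WHAT.  OWNER RULING W-ne7bp1-g104-4 released IR-104-2: END3's record is END2's `TowerExtractionPricedDataLWR` at LEVEL measures
`μ : (K j : ℕ) → Measure (X K j)` with `qA qB … extractA extractB priceA priceB` struck and the one-step rows `χ hstep hunit hint hint'
hintχ`, per bad key `MA aA bA pwA lcsA` ∕ `MB aB bB pwB lcsB` (LCS-j's `PointwiseExtraction` ∕ `LocCondStability` along `keyPattern` ∕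
`keyPatternB`) and the window ledgers `ledgerA ledgerB` added; the parameter block is END2's and the NE7c rows are END2's with the
weights over the diagonal measures `fun K => μ K K`.  Hence file 14's §1∕§2 apply with `μ := fun K => μ K K` and the order of
quantifiers is re-typed against the new record: `nonempty_towerExtractionStep_of_parametric` (a builder `∀ c ∈ grid, ∀ Wsh, (shell
display at T c) → TowerExtractionStepDataLWR … P X 𝒢 μ` + `towerShell_of_globalCompact` ⟹ `Nonempty (TowerExtractionStepDataLWR …)`, the
per-(run, string) component of END3's `hRead`) and the one call `nonempty_towerExtractionStep_of_globalCompact`.  WHAT THE BUILDER OWES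
PER ASSIGNMENT: the one-step rows at the lowered thresholds — by `LiveFactorLCS` (p359671) they may be supplied at the UNIFORM live
exponents `(aA, bA) := (λ₀²·a₁, bU)` (`pointwiseExtraction_live`, `locCondStability_mono`) with the ledger certified ONCE
(`extractionLaws_of_LCS_live`'s quotient `Π e^{bU − λ₀²a₁}` = END3's `qA` at those tables); the step kernel rows and the carriers move
with the assignment (they read `op`), the keys and key patterns do not (file 14 `carrier_eq_of_branch_eq`).

§2 WHAT.  END3's terminal theorem keeps END2's binder list (parametric in `C`, `O`; unsplit slack): road (δ)'s lowered-threshold run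
moves ONE letter (`O ↦ {O with γ₀ := λ₀²γ₀}`, with `C ↦ {C with a := λ₀²a}`, `θ ↦ λ₀²θ` riding along) —
`continuumYM4Torus_of_towerExtractionStep_live`, one application (`LiveFactorEndLetters.thresholdOK_live ∕ slack_pos_live`, file 16's unsplit
`LiveFactorTowerPriced.slack_live₁`; as file 16 for END2 and file 9 for 2R).

§3 WHAT.  The OWNER's inhabitant of LCS-j for Gaussian one-step kernels (`GaussianDominatedMoment`, t4-ne7b-p1 g105: dominated moment
`(√(1−δ))^{−r}`, tail `integral_indicator_le_of_dominated` at a threshold `θ` on the form `x·Qx`) READ WITH THE LIVE FACTOR: the tail of the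
lowered-threshold run `{x·Qx ≥ μ²θ}`, `μ ≥ λ₀ ≥ 0`, weighs at most `e^{−λ₀²θ}·(√(1−δ))^{−r}·∫e^{−x·Sx}` (`integral_indicator_le_of_dominated_live`)
— census class C1 (the extracted exponent carries `λ₀²`) while the stability factor `(√(1−δ))^{−r}` (LCS-j's `b = r·(−½log(1−δ))`) does
not see the threshold (classes C2–C5), in the owner's model currency.

INPUTS LEFT (located, NOT discharged — as files 14∕16): the realized ledgers for every grid assignment ((L1-levelwise)); (L2↓); (FD);
floors; the window majorant; node O (the live record).  NE7c NOT proved.  HONEST DEPENDENCY (cell): continuum YM on T⁴ ⇐ BetaPertH ∧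
nine spine estimates (0∕9 proved); BetaPertH ⇐ (D1) ∧ (D4) ∧ CAP+tail.  This file changes none of it.
-/

namespace Summit.QuantumFields.BalabanUV.T4Continuum.Spine.NE7c.LiveFactorTowerStep

open Finset MeasureTheory
open Literature.MathematicalPhysics.QuantumFieldTheory.Balaban1983to89
open Literature.MathematicalPhysics.QuantumFieldTheory.Balaban1983to89.T4ShellMeasure
open Literature.MathematicalPhysics.QuantumFieldTheory.Balaban1983to89.T4Continuum
open Summit.QuantumFields.BalabanUV.T4Continuum.HistoryConstants
open Summit.QuantumFields.BalabanUV.T4Continuum.B16HistoryIndexedRepr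
open Summit.QuantumFields.BalabanUV.T4Continuum.B16HistoryIndexedTrunc
open Summit.QuantumFields.BalabanUV.T4Continuum.B16HistoryReprChain
open Summit.QuantumFields.BalabanUV.T4Continuum.B16HistoryReprInstance
open Summit.QuantumFields.BalabanUV.T4Continuum.B16HistoryTowerExtractionStepDataLWR
open Summit.QuantumFields.BalabanUV.T4Continuum.Spine.NE7c.LiveFactorGlobalCompact
open Summit.QuantumFields.BalabanUV.T4Continuum.Spine.NE7c.LiveFactorTowerShell

/-! ## §1 Against END3's record: the order of quantifiers of a threshold-parametric (A1c-0) builder -/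

section Record

variable {F : T4Family} {G : Type*} [GaugeGroup G] [MeasurableSpace G] [HaarData G]
  {D : FiniteEpsData F G} {Cn : T4PrintedShapeBanking.Consts} {O : PrintedO1s} {θv : ℝ} {rr d n : ℕ}
  {hn : 0 < n} {g₀ : ℕ → ℝ} {os : List (ULoop F)} {cΛ M Φ β₀ : ℝ} {p₁ η η' κ κ₂ κᵥ : ℕ}
  {P : Type} [DecidableEq P] {X : ℕ → ℕ → Type} {𝒢 : (K j : ℕ) → GoodClass (X K j)}
  [∀ K j, MeasurableSpace (X K j)] {μ : (K j : ℕ) → Measure (X K j)} [∀ K, IsFiniteMeasure (μ K K)]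

/-- **END3's RECORD FROM A THRESHOLD-PARAMETRIC BUILDER AND THE JUNCTION** (interface word J-δ∕IR1042; logically one application).
A builder returning END3's record `TowerExtractionStepDataLWR … P X 𝒢 μ` from the `shell` display at the tower `T c` (weights over the
diagonal measures `fun K => μ K K`) for EVERY grid assignment `c`, with `LiveFactorTowerShell.towerShell_of_globalCompact`'s output, inhabits
the record — the component `Nonempty (TowerExtractionStepDataLWR …)` of END3's `hRead`.  Nothing discharged. [folklore] -/
theorem nonempty_towerExtractionStep_of_parametric
    (T : (ℕ → ℕ) → (K : ℕ) → Tower P (X K) (𝒢 K)) (p₀ : ℕ → ℕ → P) (ρ₀ : (ℕ → ℕ) → (K : ℕ) → ℝ → X K 0 → ℝ)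
    (hρ₀ : ∀ c K t, (𝒢 K 0).Gd (ρ₀ c K t)) (h0 : ∀ c K t x, 0 ≤ ρ₀ c K t x)
    (trunc : (c : ℕ → ℕ) → ℕ → HIndex.Idx (skelFam (T c) p₀) → HIndex.Idx (skelFam (T c) p₀))
    (nC : ℕ → ℕ) {l₀ : ℝ} (shA shB : (c : ℕ → ℕ) → ℕ → ℝ → HIndex.Idx (skelFam (T c) p₀) → ℝ)
    (build : ∀ c : ℕ → ℕ, (∀ j, c j < nC j) → ∀ Wsh : ℕ → ℝ,
      T4IndicatorShell.ShellWeightBound l₀ (HIndex.termSet (skelFam (T c) p₀))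
        (fun _ t => Repr172R.weight (fun K => μ K K)
          (reprFam (T c) p₀ (ρ₀ c) (hρ₀ c) (h0 c) (fun _ _ => 1) (fun _ _ => one_pos)) t)
        (weightB (fun K => μ K K) (reprFam (T c) p₀ (ρ₀ c) (hρ₀ c) (h0 c) (fun _ _ => 1) (fun _ _ => one_pos)) (trunc c))
        (shA c) (shB c) Wsh →
      TowerExtractionStepDataLWR D Cn O θv rr d n hn g₀ os cΛ M Φ β₀ p₁ η η' κ κ₂ κᵥ P X 𝒢 μ)
    (hshell : ∃ c : ℕ → ℕ, (∀ j, c j < nC j) ∧ ∃ Wsh : ℕ → ℝ,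
      T4IndicatorShell.ShellWeightBound l₀ (HIndex.termSet (skelFam (T c) p₀))
        (fun _ t => Repr172R.weight (fun K => μ K K)
          (reprFam (T c) p₀ (ρ₀ c) (hρ₀ c) (h0 c) (fun _ _ => 1) (fun _ _ => one_pos)) t)
        (weightB (fun K => μ K K) (reprFam (T c) p₀ (ρ₀ c) (hρ₀ c) (h0 c) (fun _ _ => 1) (fun _ _ => one_pos)) (trunc c))
        (shA c) (shB c) Wsh) :
    Nonempty (TowerExtractionStepDataLWR D Cn O θv rr d n hn g₀ os cΛ M Φ β₀ p₁ η η' κ κ₂ κᵥ P X 𝒢 μ) := by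
  obtain ⟨c, hc, Wsh, h⟩ := hshell
  exact ⟨build c hc Wsh h⟩

/-- **ONE CALL: MEMBER (δ-global-compact) AT THE TOWER ⇒ END3's RECORD**, for a threshold-parametric builder —
`LiveFactorTowerShell.towerShell_of_globalCompact` at the diagonal measures `fun K => μ K K` fed to
`nonempty_towerExtractionStep_of_parametric`; file 11's located inputs at the tower's carriers VERBATIM as file 14.  Nothing
discharged; NE7c NOT proved (INSTANCE 0∕1: the builder is node O's). [folklore] -/
theorem nonempty_towerExtractionStep_of_globalCompact
    (T : (ℕ → ℕ) → (K : ℕ) → Tower P (X K) (𝒢 K)) (hbr : ∀ c c' K, (T c K).branch = (T c' K).branch)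
    (p₀ : ℕ → ℕ → P) (ρ₀ : (ℕ → ℕ) → (K : ℕ) → ℝ → X K 0 → ℝ)
    (hρ₀ : ∀ c K t, (𝒢 K 0).Gd (ρ₀ c K t)) (h0 : ∀ c K t x, 0 ≤ ρ₀ c K t x)
    (trunc : (c : ℕ → ℕ) → ℕ → HIndex.Idx (skelFam (T c) p₀) → HIndex.Idx (skelFam (T c) p₀))
    {l₀ a C ϑ : ℝ} (nC : ℕ → ℕ) (hnC : ∀ j, 0 < nC j) (B W : ℕ → Finset ℕ) (hWB : ∀ K j, j ∈ W K → K ∈ B j)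
    {σ σ' : Type*} (shA shB : (c : ℕ → ℕ) → ℕ → ℝ → HIndex.Idx (skelFam (T c) p₀) → ℝ)
    (SA : ℕ → Finset σ) (SB : ℕ → Finset σ')
    (pieceA : (c : ℕ → ℕ) → ℕ → ℝ → σ → HIndex.Idx (skelFam (T c) p₀) → ℝ)
    (pieceB : (c : ℕ → ℕ) → ℕ → ℝ → σ' → HIndex.Idx (skelFam (T c) p₀) → ℝ)
    (build : ∀ c : ℕ → ℕ, (∀ j, c j < nC j) → ∀ Wsh : ℕ → ℝ,
      T4IndicatorShell.ShellWeightBound l₀ (HIndex.termSet (skelFam (T c) p₀))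
        (fun _ t => Repr172R.weight (fun K => μ K K)
          (reprFam (T c) p₀ (ρ₀ c) (hρ₀ c) (h0 c) (fun _ _ => 1) (fun _ _ => one_pos)) t)
        (weightB (fun K => μ K K) (reprFam (T c) p₀ (ρ₀ c) (hρ₀ c) (h0 c) (fun _ _ => 1) (fun _ _ => one_pos)) (trunc c))
        (shA c) (shB c) Wsh →
      TowerExtractionStepDataLWR D Cn O θv rr d n hn g₀ os cΛ M Φ β₀ p₁ η η' κ κ₂ κᵥ P X 𝒢 μ)
    (hLA : ∀ c : ℕ → ℕ, (∀ j, c j < nC j) →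
      SlotLedger l₀ (HIndex.termSet (skelFam (T c) p₀))
        (fun _ t => Repr172R.weight (fun K => μ K K)
          (reprFam (T c) p₀ (ρ₀ c) (hρ₀ c) (h0 c) (fun _ _ => 1) (fun _ _ => one_pos)) t)
        (shA c) SA (pieceA c)
        (fun K s => Real.exp (2 * a) *
          ((∑ τ ∈ HIndex.termSet (skelFam (T c) p₀) K, pieceA c K 0 s τ) /
            ∑ τ ∈ HIndex.termSet (skelFam (T c) p₀) K,
              Repr172R.weight (fun K => μ K K)
                (reprFam (T c) p₀ (ρ₀ c) (hρ₀ c) (h0 c) (fun _ _ => 1) (fun _ _ => one_pos)) 0 τ)))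
    (hLB : ∀ c : ℕ → ℕ, (∀ j, c j < nC j) →
      SlotLedger l₀ (HIndex.termSet (skelFam (T c) p₀))
        (weightB (fun K => μ K K) (reprFam (T c) p₀ (ρ₀ c) (hρ₀ c) (h0 c) (fun _ _ => 1) (fun _ _ => one_pos)) (trunc c))
        (shB c) SB (pieceB c)
        (fun K s => Real.exp (2 * a) *
          ((∑ τ ∈ HIndex.termSet (skelFam (T c) p₀) K, pieceB c K 0 s τ) /
            ∑ τ ∈ HIndex.termSet (skelFam (T c) p₀) K,
              weightB (fun K => μ K K)
                (reprFam (T c) p₀ (ρ₀ c) (hρ₀ c) (h0 c) (fun _ _ => 1) (fun _ _ => one_pos)) (trunc c) K 0 τ)))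
    {ZA ZB : ℕ → ℝ} (hZA : ∀ K, 0 < ZA K) (hZB : ∀ K, 0 < ZB K)
    (hZAle : ∀ c : ℕ → ℕ, (∀ j, c j < nC j) → ∀ K,
      ZA K ≤ ∑ τ ∈ HIndex.termSet (skelFam (T c) p₀) K,
        Repr172R.weight (fun K => μ K K)
          (reprFam (T c) p₀ (ρ₀ c) (hρ₀ c) (h0 c) (fun _ _ => 1) (fun _ _ => one_pos)) 0 τ)
    (hZBle : ∀ c : ℕ → ℕ, (∀ j, c j < nC j) → ∀ K,
      ZB K ≤ ∑ τ ∈ HIndex.termSet (skelFam (T c) p₀) K,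
        weightB (fun K => μ K K)
          (reprFam (T c) p₀ (ρ₀ c) (hρ₀ c) (h0 c) (fun _ _ => 1) (fun _ _ => one_pos)) (trunc c) K 0 τ)
    (wA wB : ℕ → ℕ → (ℕ → ℕ) → ℝ) (hA0 : ∀ K j c, 0 ≤ wA K j c) (hB0 : ∀ K j c, 0 ≤ wB K j c)
    (Dp : ℕ → ℕ → ℕ)
    (hdepA : ∀ K j (c c' : ℕ → ℕ), (∀ l, c l < nC l) → (∀ l, c' l < nC l) → (∀ l, l < Dp K j → c l = c' l) →
      wA K j c = wA K j c')
    (hdepB : ∀ K j (c c' : ℕ → ℕ), (∀ l, c l < nC l) → (∀ l, c' l < nC l) → (∀ l, l < Dp K j → c l = c' l) →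
      wB K j c = wB K j c')
    (V : ℕ → ℝ) (hV : ∀ j, 0 ≤ V j)
    (hA : ∀ K j (c : ℕ → ℕ), (∀ l, c l < nC l) →
      ∑ m ∈ range (nC j), wA K j (Function.update c j m) ≤ V j * ZA K)
    (hB : ∀ K j (c : ℕ → ℕ), (∀ l, c l < nC l) →
      ∑ m ∈ range (nC j), wB K j (Function.update c j m) ≤ V j * ZB K)
    (hcovA : ∀ c : ℕ → ℕ, (∀ j, c j < nC j) → ∀ K,
      ∑ s ∈ SA K, ∑ τ ∈ HIndex.termSet (skelFam (T c) p₀) K, pieceA c K 0 s τ ≤ ∑ j ∈ W K, wA K j c)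
    (hcovB : ∀ c : ℕ → ℕ, (∀ j, c j < nC j) → ∀ K,
      ∑ s ∈ SB K, ∑ τ ∈ HIndex.termSet (skelFam (T c) p₀) K, pieceB c K 0 s τ ≤ ∑ j ∈ W K, wB K j c)
    (t : ℕ → ℝ) (ht0 : ∀ j, 0 < t j) (ht : ∀ J, ∑ j ∈ range J, (t j)⁻¹ < 1)
    (hϑ0 : 0 ≤ ϑ) (hϑ1 : ϑ < 1)
    (hgeo : ∀ K, ∑ j ∈ W K, t j * (2 * ((B j).card : ℝ) * V j / nC j) ≤ C * ϑ ^ K) :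
    Nonempty (TowerExtractionStepDataLWR D Cn O θv rr d n hn g₀ os cΛ M Φ β₀ p₁ η η' κ κ₂ κᵥ P X 𝒢 μ) :=
  nonempty_towerExtractionStep_of_parametric T p₀ ρ₀ hρ₀ h0 trunc nC shA shB build
    (towerShell_of_globalCompact (fun K => μ K K) T hbr p₀ ρ₀ hρ₀ h0 trunc nC hnC B W hWB shA shB SA SB pieceA pieceB
      hLA hLB hZA hZB hZAle hZBle wA wB hA0 hB0 Dp hdepA hdepB V hV hA hB hcovA hcovB t ht0 ht hϑ0 hϑ1 hgeo)

end Record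

/-! ## §2 END3's ROAD at road (δ)'s live letters: one moved letter, one `exact` -/

section End3Live

open T4PrintedShapeBanking T4CanonicalMenus
open Summit.QuantumFields.BalabanUV.T4Continuum.HistoryZoneEvolve (cth)
open Summit.QuantumFields.BalabanUV.T4Continuum.CountThresholdUniform
open Summit.QuantumFields.BalabanUV.T4Continuum.B16HistoryTowerExtractionEnd3
open Summit.QuantumFields.BalabanUV.T4Continuum.Spine.NE7c.LiveFactorEndLetters
open Summit.QuantumFields.BalabanUV.T4Continuum.Spine.NE7c.LiveFactorTowerPriced (slack_live₁)

variable {lam₀ : ℝ}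

variable {F : T4Family} {N : ℕ} [NeZero N] {ℰ : LoopAverage (Matrix.specialUnitaryGroup (Fin N) ℂ)}

/-- **END3 AT THE TOWER («extraction DERIVED from LCS-j»), AT ROAD (δ)'s LIVE LETTERS.**  END3's terminal theorem
`continuumYM4Torus_of_towerExtractionStep_fsc` with its constants-only side conditions AT PRINT's LETTERS and — for all small-coupling tuned
runs and every loop string — SOME one-step record OF THE LOWERED-THRESHOLD RUN, `TowerExtractionStepDataLWR D {C with a := λ₀²a}
{O with γ₀ := λ₀²γ₀} θv' …` (its `pwA ∕ lcsA ∕ ledgerA` rows at live exponents — §3 —, price at the live shape price), ⟹ `ContinuumYM4Torus D`.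
One application at the live letters (`thresholdOK_live`, `slack_pos_live`, `LiveFactorTowerPriced.slack_live₁`).  CONDITIONAL on everything the live record
displays (node O's to inhabit); NE7c ∕ NE7b NOT proved; count 0∕9. [folklore] -/
theorem continuumYM4Torus_of_towerExtractionStep_live (D : FiniteEpsData F (Matrix.specialUnitaryGroup (Fin N) ℂ))
    (hBA : D.IsBlockAveraged ℰ) (hE : ℰ.MeasurableE) (hB : B16.EndStatementBPrinted D.C) (hβ : BetaPertHyp D.βfun)
    (h0 : 0 < lam₀) {C : T4PrintedShapeBanking.Consts} {O : PrintedO1s}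
    {rr : ℕ} {β₀ : ℝ} (h : ThresholdOK C F.L rr β₀) (hμ : 0 < C.μ) (d n : ℕ)
    (hκ₁ : (d : ℝ) * Real.log F.L + 2 * Real.log 2 ≤ C.κ₁) (hE₀ : Real.log (2 + birthMass C) ≤ C.E₀)
    (hA₀ : 1 ≤ C.A₀) (hβ₀ : 0 < β₀) (hLβ : (F.L : ℝ) * β₀ ≤ 1) (hn₁ : 13 ≤ C.n₁) (hn : 0 < n)
    {θ : ℝ} (hθ : 0 < θ) (hslack : C.a + θ ≤ O.γ₀ * O.A₁ ^ 2 / 2)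
    (hE₂ : 0 < C.E₂) (hE₃ : 0 ≤ C.E₃) {sS : ℕ} (hsS : 1 ≤ sS)
    (hsmall : (((2 * cth 32 1 sS + 1) ^ d : ℕ) : ℝ) * (5 : ℝ) ^ d * ((max 1 (2 * 32 + 2) : ℕ) : ℝ) ≤
      (F.L : ℝ) ^ (sS / 2) / 2)
    {θc : ℝ} (hθc0 : 0 ≤ θc) (hθc1 : θc < 1) (hθcs : 1 / 2 ≤ θc ^ sS)
    {θv' cΛ M Φ b₀ : ℝ} {p₁ η η' κ κ₂ κᵥ : ℕ}
    (hRead : T4ContinuumYM4Torus.ForSmallCouplings D fun g₀ => ∀ os : List (ULoop F),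
      ∃ (P : Type) (_ : DecidableEq P) (X : ℕ → ℕ → Type) (𝒢 : (K j : ℕ) → GoodClass (X K j))
        (_ : ∀ K j, MeasurableSpace (X K j)) (μ : (K j : ℕ) → Measure (X K j)) (_ : ∀ K, IsFiniteMeasure (μ K K)),
        Nonempty (TowerExtractionStepDataLWR D { C with a := lam₀ ^ 2 * C.a } { O with γ₀ := lam₀ ^ 2 * O.γ₀ } θv'
          rr d n hn g₀ os cΛ M Φ b₀ p₁ η η' κ κ₂ κᵥ P X 𝒢 μ)) :
    T4ContinuumYM4Torus.ContinuumYM4Torus D :=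
  continuumYM4Torus_of_towerExtractionStep_fsc D hBA hE hB hβ (thresholdOK_live h0 h) hμ d n hκ₁ hE₀ hA₀ hβ₀ hLβ hn₁ hn
    (slack_pos_live h0 hθ) (slack_live₁ C O hslack) hE₂ hE₃ hsS hsmall hθc0 hθc1 hθcs hRead

end End3Live


/-! ## §3 The OWNER's Gaussian inhabitant of LCS-j at the live letters (model level; says nothing about Bałaban's kernels) -/

section GaussianLive

open Matrix
open Summit.QuantumFields.BalabanUV.T4Continuum.NE7b.GaussianDominatedMoment

variable {n : Type*} [Fintype n] [DecidableEq n]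

/-- **THE GAUSSIAN LARGE-FIELD TAIL OF THE LOWERED-THRESHOLD RUN** (census class C1 in the OWNER's currency, t4-ne7b-p1 g105
`GaussianDominatedMoment`): for a positive-definite `S`, a positive-semidefinite `Q ≤ δS` (`0 ≤ δ < 1`) of rank `≤ r`, a threshold
`θ ≥ 0` lowered to `μ²θ` with the live factor `μ ≥ λ₀ ≥ 0` (quadratic dictionary), the tail `{x·Qx ≥ μ²θ}` weighs at most
`e^{−λ₀²θ}·(√(1−δ))^{−r}·∫e^{−x·Sx}` — the owner's `integral_indicator_le_of_dominated` AT `μ²θ` and monotonicity of `exp`; the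
stability factor `(√(1−δ))^{−r}` (LCS-j's `b = r·(−½log(1−δ))`) does not see the threshold. [folklore] -/
theorem integral_indicator_le_of_dominated_live {S Q : Matrix n n ℝ} {δ : ℝ} {r : ℕ} (hS : S.PosDef) (hQ : Q.PosSemidef)
    (hdom : (δ • S - Q).PosSemidef) (hδ0 : 0 ≤ δ) (hδ : δ < 1) (hr : Q.rank ≤ r) {θ lam₀ μ : ℝ} (hθ : 0 ≤ θ)
    (h0 : 0 ≤ lam₀) (hμ : lam₀ ≤ μ) :
    ∫ x, Set.indicator {x | μ ^ 2 * θ ≤ x ⬝ᵥ (Q *ᵥ x)} (fun _ => (1 : ℝ)) x * Real.exp (-(x ⬝ᵥ (S *ᵥ x))) ≤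
      Real.exp (-(lam₀ ^ 2 * θ)) * (√(1 - δ))⁻¹ ^ r * ∫ x, Real.exp (-(x ⬝ᵥ (S *ᵥ x))) := by
  refine (integral_indicator_le_of_dominated hS hQ hdom hδ0 hδ hr (μ ^ 2 * θ)).trans ?_
  have hI : 0 ≤ (√(1 - δ))⁻¹ ^ r * ∫ x, Real.exp (-(x ⬝ᵥ (S *ᵥ x))) :=
    mul_nonneg (pow_nonneg (inv_nonneg.2 (Real.sqrt_nonneg _)) _) (integral_nonneg fun x => (Real.exp_pos _).le)
  have h1 : lam₀ ^ 2 * θ ≤ μ ^ 2 * θ := mul_le_mul_of_nonneg_right (pow_le_pow_left₀ h0 hμ 2) hθ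
  rw [mul_assoc, mul_assoc]
  exact mul_le_mul_of_nonneg_right (Real.exp_le_exp.2 (by linarith)) hI

end GaussianLive

end Summit.QuantumFields.BalabanUV.T4Continuum.Spine.NE7c.LiveFactorTowerStep
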